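import Summits.CriticalPhenomena.SAWScalingLimit.Theses.SAWLeftRightFKG
import Summits.CriticalPhenomena.SAWScalingLimit.Theses.SAWBrownianDomination
import Summits.CriticalPhenomena.SAWScalingLimit.Theorems.FKGToTraversalBound.Negative.DeepEndpointGap
import Summits.CriticalPhenomena.SAWScalingLimit.Theorems.TPToTraversalBound.Negative.TPToTraversalBoundLogic
import Summits.CriticalPhenomena.SAWScalingLimit.Theorems.TPToTraversalBound.Negative.TPToTraversalBoundDeepStart
import Literature.Probability.RandomPlanarGeometry.CrossingCondition

/-!
# Line `brownian-domination-closes-g2` — skeleton for crux `FKGToTraversalBound` (stmt-CriticalPhenomena-1878)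

Crux (route `SAWLeftRightFKG`, rank 3):
`FKGToTraversalBound := LeftRightFKG → SAWTraversalBound` (`Iff.rfl`, Disproof §1 `iff_imp`), i.e.
left–right positive association (PA) of the critical square-lattice SAW should give the
Aizenman–Burchard hypothesis (H1) for the chordal critical SAW in every Dobrushin domain and every
endpoint approximation.  By Disproof F1 (`not_crux_iff`, `mono_hyp`, `of_traversalBound`) the crux is
monotone in its hypothesis and NO `_false_without_` certificate exists: a line may prove
`WithoutPA := SAWTraversalBound` outright.  THIS LINE DOES EXACTLY THAT — PA is idle (triage r1-2 (c));
its ε comes from harmonic measure (Brownian/random-walk domination), not from association.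

Idea (card `Ideas/brownian-domination-closes-g2.md`; triage r1: pass/fail/pass/fail-with-survivor, all
three triagers agree on what survives): Kemppainen–Smirnov's Condition G2 never charges an empty
annulus (KS17 arXiv:1212.6215v3 Def. 2.2, p. 9: `A^u_τ = ∅` when `∂B(z₀,r) ∩ ∂U_τ = ∅`), so for a curve
with an EXACT domain Markov property every charged (unforced) crossing is a visit deep into a
dead-end fjord of the slit domain `Ω_δ ∖ past`; a Hölder-weak BROWNIAN DOMINATION inequality
`P_SAW[hit S | avoid F] ≤ C · P_RW-exc[hit S]^θ` then transfers G2 to a RANDOM-WALK statement, and the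
random-walk side is the (weak) discrete Beurling estimate.  KS17 §3.2 (Prop. 3.5, Lemma 3.6) turns
G2 into the AB multiple-crossing bound = (H1) with a shell-dependent threshold.

Scope forced by the panel (Disproof F3 / repair R1; triage X1 = S1 = P1, with numbers): the seed
is the REPAIRED domination statement C′ of route `SAWBrownianDomination` (item stmt-11295 is
refuted-misstated AS TYPED by the two-corridor ring around a FLOATING obstacle, kit j002972; the
refuter's repair `UniformDominationBoundaryAttached` adds `u ∈ meshBoundary`, W2.lean on that item),
and G2 itself is FALSE for the x_c-SAW once the past floats (deep start; triage S1 table: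
P(unforced crossing | past) = .905 … .996 for L = 2 … 12).  Hence stubs 3–4 are typed on the R1 class
(both lattice endpoints on `meshBoundary`), and the deep-endpoint fragment of (H1) — on which no
engine uniform in the past can work — is the separate, honestly open `stub_deepEndpointReduction`
(Disproof F3 "add a separate item 'deep-endpoint reduction'"; shared IOU of every line on this crux).

Stubs (5; `sorry` only there):
* `stub_domination` — SEED, conjecture-grade, HARDEST: boundary-attached Hölder-weak domination C′
  (= the repair of `SAWBrownianDomination.UniformDomination`; `dominationBdry_of_uniformDomination`
  records that the as-typed item implies it, so a proof there closes this stub).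
* `stub_rwWeakBeurling` — theorem-grade (Kesten / Lawler–Limic weak Beurling): the killed simple
  random walk started at radius `≥ R` reaches `B̄(z₀, r)` before leaving `B(z₀, 2R)` with probability
  `≤ c₁ (r/R)^β` when a CONNECTED obstacle untouched by the allowed edges joins `B̄(z₀,r)` to `∁B(z₀,R)`.
* `stub_g2_of_domination` — C′ + weak Beurling ⇒ `G2SAW` (KS G2 at lattice prefixes, R1 class):
  exact DMP of `SAW.law`; an unforced component is a one-sided dead end whose walls (past ∪ anchor ∪
  exterior) form the connected obstacle; domination + dead-end Harnack at the mouth + Beurling.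
* `stub_h1_of_g2` — `G2SAW` ⇒ (H1) on the R1 class: KS17 Prop. 3.5 / Lemma 3.6 index argument run
  in the Jordan domain itself, forced crossings of `∂D` absorbed into the shell threshold `k(x,ρ,R)`
  (template `fkInterface_traversalBound_of_annulusCrossing_le`).
* `stub_deepEndpointReduction` — (H1) on the R1 class ⇒ (H1) for all `IsEndpointApprox` (open).

`FKGToTraversalBound_of` concludes the crux BY NAME (PA discarded: `fun _ => …`).
-/

noncomputable section

open MeasureTheory Filter Topology Set Metric
open scoped NNReal ENNReal
open Literature.Probability.LatticeModels
open Literature.Probability.RandomPlanarGeometry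
open Literature.Probability.RandomPlanarGeometry.SAW
open Summit.CriticalPhenomena.SAWScalingLimit.Theses.SAWLeftRightFKG

namespace Summit.CriticalPhenomena.SAWScalingLimit.Cruxes.FKGToTraversalBound.BrownianDominationClosesG2

/-! ## Statements of the line -/

/-- **Boundary-attached Hölder-weak Brownian domination** (the seed; = the refuter's repair C′
`UniformDominationBoundaryAttached` of `SAWBrownianDomination.UniformDomination`, stmt-11295): there
are `C` and `θ > 0` such that for every Jordan domain `J`, mesh `δ > 0`, lattice walk `η : u → v` of
`Ω_δ` STARTING ON THE LATTICE BOUNDARY (`u ∈ meshBoundary`; forbidden set `F := η.support`, so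
`Ω_δ ∖ F` stays lattice-simply-connected — this excludes the two-corridor ring witness, kit j002972),
target `S ⊆ ℤ²` and sites `z, w`:
`law(z→w){avoid F ∧ hit S} · (Σ_{ω avoiding F} 4^{-|ω|})^θ ≤ C · law{avoid F} · (Σ_{ω avoiding F, hitting S} 4^{-|ω|})^θ`,
i.e. `P_SAW[hit S | avoid F] ≤ C · (P_RW-excursion in Ω_δ∖F [hit S])^θ`, cross-multiplied in `ℝ≥0∞`.
Used here ONLY with `J = D.carrier`, `η` = a SAW prefix from `a_δ ∈ meshBoundary` minus its last
step, `z` = tip, `w = b_δ`, `S` = the trap of an unforced annulus component. -/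
def DominationBdry : Prop :=
  ∃ (C : ℝ≥0) (θ : ℝ), 0 < θ ∧ ∀ (J : JordanDomain) (δ : ℝ) (u v : Site 2)
    (η : (discreteDomainGraph J.carrier δ).Walk u v) (S : Set (Site 2)) (z w : Site 2),
    0 < δ → u ∈ meshBoundary J.carrier δ →
      law J.carrier δ z w
            {γ | (∀ x ∈ γ.walk.support, x ∉ η.support) ∧ ∃ x ∈ γ.walk.support, x ∈ S} *
          (∑' ω : (discreteDomainGraph J.carrier δ).Walk z w,
              Set.indicator {ω' | ∀ x ∈ ω'.support, x ∉ η.support}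
                (fun ω' => (4 : ℝ≥0∞)⁻¹ ^ ω'.length) ω) ^ θ ≤
        (C : ℝ≥0∞) *
          law J.carrier δ z w {γ | ∀ x ∈ γ.walk.support, x ∉ η.support} *
            (∑' ω : (discreteDomainGraph J.carrier δ).Walk z w,
                Set.indicator {ω' | (∀ x ∈ ω'.support, x ∉ η.support) ∧ ∃ x ∈ ω'.support, x ∈ S}
                  (fun ω' => (4 : ℝ≥0∞)⁻¹ ^ ω'.length) ω) ^ θ

/-- **Weak discrete Beurling estimate for the killed walk** (Kesten; Lawler 1991 Thm 2.5.2 /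
Lawler–Limic 2010 §6.8, weak form — ANY exponent `β > 0` suffices for this line): there are `β > 0`
and `c₁` such that for every domain `Ω`, mesh `δ > 0`, forbidden site set `F`, annulus radii
`δ ≤ r`, `4r ≤ R`, and every CONNECTED set `K ⊆ ℂ` that meets `B̄(z₀, r)`, is not contained in
`B(z₀, R)` (so it crosses every circle of `A(z₀, r, R)`) and is disjoint from every ALLOWED edge
(segment between adjacent sites of `Ω_δ` outside `F`), the `4^{-|ω|}`-mass of the walks of `Ω_δ`
avoiding `F` that start at a site `s` with `|δs - z₀| ≥ R`, stay inside `B(z₀, 2R)` and at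
distance `> r` from `z₀` until their last vertex, which lies in `B̄(z₀, r)` — i.e. the probability
that simple random walk on `δℤ²` from `s`, killed when it attempts a non-allowed step, reaches
`B̄(z₀, r)` before leaving `B(z₀, 2R)` — is at most `c₁ (r/R)^β`.  (Proof route: at each dyadic
scale the free walk closes a loop around the annulus with probability `≥ c` before going down one
scale; such a loop meets `K`, hence uses a non-allowed edge.) -/
def RWWeakBeurling : Prop :=
  ∃ (β c₁ : ℝ), 0 < β ∧ ∀ (Ω : Set ℂ) (δ : ℝ) (F : Set (Site 2)) (K : Set ℂ) (z₀ : ℂ) (r R : ℝ)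
    (s : Site 2), 0 < δ → δ ≤ r → 4 * r ≤ R → IsConnected K → (K ∩ closedBall z₀ r).Nonempty →
    ¬ K ⊆ ball z₀ R →
    (∀ x y : Site 2, (discreteDomainGraph Ω δ).Adj x y → x ∉ F → y ∉ F →
      Disjoint (segment ℝ (meshPoint δ x) (meshPoint δ y)) K) →
    s ∉ F → R ≤ dist (meshPoint δ s) z₀ →
      (∑' (t : Site 2), ∑' (ω : (discreteDomainGraph Ω δ).Walk s t),
          Set.indicator
            {ω' | (∀ x ∈ ω'.support, x ∉ F) ∧ dist (meshPoint δ t) z₀ ≤ r ∧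
              (∀ x ∈ ω'.support.dropLast, r < dist (meshPoint δ x) z₀) ∧
              ∀ x ∈ ω'.support, dist (meshPoint δ x) z₀ < 2 * R}
            (fun ω' => (4 : ℝ≥0∞)⁻¹ ^ ω'.length) ω) ≤
        ENNReal.ofReal (c₁ * (r / R) ^ β)

/-- **The carrier rooted at a lattice boundary site `v`.**  The polyline of a lattice past starting
at `v ∈ meshBoundary Ω δ` does not touch `∂Ω` (its root `δv` is an interior point), so in the
CONTINUUM slit domain `Ω ∖ past` the past would be a floating arc that continuum paths can
circumnavigate through the site-free gap at the root — and KS's continuum notion "`C` does not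
disconnect the tip from `b`" would then deem some LATTICE-FORCED crossings avoidable (e.g. a
corridor of width `R` with the past up its middle and `b_δ` on the far side of the root: conditional
probability `1`).  Lattice walks cannot use that gap: `v ∈ meshBoundary` means some `ℤ²`-neighbour
`y` of `v` is not joined to `v` in `Ω_δ`, and no edge of `Ω_δ` crosses the open segment `(δv, δy)`
(lattice segments meet only at lattice points).  We therefore ROOT the slit domain: remove from `Ω`
the segments from `δv` towards every such `y` (keeping `δy` itself, which may be a usable site when
only the edge is missing).  Then `ℂ ∖ (rooted carrier ∖ past) = Ωᶜ ∪ roots ∪ past` is connected and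
unbounded (each root `[δv, δy)` reaches `Ωᶜ`: either `y ∉ Ω`, or the segment leaves `closure Ω`),
which is exactly the hypothesis of the free-loop consistency between continuum and lattice
avoidability (card `free-loop-rerouting`, triage: `FreeLoop` true; Disproof §6 `noFloatingHoles` is
the r2-class version).  If `v ∉ meshBoundary` nothing is removed. -/
def rootedCarrier (Ω : Set ℂ) (δ : ℝ) (v : Site 2) : Set ℂ :=
  Ω \ ⋃ y ∈ {y : Site 2 | (zdGraph 2).Adj v y ∧ ¬ (discreteDomainGraph Ω δ).Adj v y},
    (segment ℝ (meshPoint δ v) (meshPoint δ y) \ {meshPoint δ y})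

/-- **Kemppainen–Smirnov's Condition G2 for the chordal critical SAW, at lattice stopping times, on
the R1 class** (KS17 arXiv:1212.6215v3 §2.1.3 Condition G2 with Def. 2.2; Cor. 2.6: any constant in
`(0,1)`; Remark 2.8: under the exact domain Markov property the prefix-conditioned form is the
relevant one).  For every Dobrushin domain and endpoint approximation whose lattice endpoints
eventually lie on the lattice boundary `meshBoundary` (R1 — the class on which the past is
boundary-attached; for floating pasts the statement is FALSE, triage S1), there are `C₀ > 1` and
`δ₀ > 0` such that for every mesh `δ ≤ δ₀`, every lattice PREFIX `π : a_δ → t` (the past; exact DMP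
stopping time), and every annulus `A(z₀, r, R)` with `δ ≤ r`, `C₀ r ≤ R`:
`P(γ extends π and its continuation makes a crossing of A contained in A^u_π) ≤ ½ · P(γ extends π)`,
where `A^u_π = unforcedPart (rootedCarrier D δ a_δ) (δ b_δ) [π] z₀ r R` is KS's avoidable set for
the ROOTED slit domain `D ∖ (roots ∪ π[0,1])`, tip `π(1)`, target `δ b_δ` (tree definition, Def. 2.2
verbatim incl. the empty-annulus clause), and the crossing is KS Def. 1.1 (`Curve.MakesCrossingIn`)
for the continuation's polyline.  Constants are per `(D, a, b)` (weaker than KS's uniform `C`;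
enough for (H1), whose exponent grows with the threshold).  Scope note (shared with the tree's
`ConditionG2`): a crossing whose interior touches `∂D` is not "contained in `A^u`" and is not
charged. -/
def G2SAW : Prop :=
  ∀ (D : DobrushinDomain) (a b : ℝ → Site 2), IsEndpointApprox D a b →
    (∀ᶠ δ in 𝓝[>] (0 : ℝ), a δ ∈ meshBoundary D.carrier δ ∧ b δ ∈ meshBoundary D.carrier δ) →
    ∃ (C₀ δ₀ : ℝ), 1 < C₀ ∧ 0 < δ₀ ∧ ∀ δ ∈ Set.Ioc (0 : ℝ) δ₀,
      ∀ (t : Site 2) (π : (discreteDomainGraph D.carrier δ).Walk (a δ) t) (z₀ : ℂ) (r R : ℝ),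
        δ ≤ r → C₀ * r ≤ R →
        law D.carrier δ (a δ) (b δ)
            {γ | ∃ ω : (discreteDomainGraph D.carrier δ).Walk t (b δ), γ.walk = π.append ω ∧
              (⟨ω.toCurve (meshPoint δ)⟩ : Curve ℂ).MakesCrossingIn z₀ r R
                (unforcedPart (rootedCarrier D.carrier δ (a δ)) (meshPoint δ (b δ))
                  (CurveClass.mk ⟨π.toCurve (meshPoint δ)⟩) z₀ r R)} ≤
          2⁻¹ * law D.carrier δ (a δ) (b δ)
            {γ | ∃ ω : (discreteDomainGraph D.carrier δ).Walk t (b δ), γ.walk = π.append ω}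

/-- **(H1) on the R1 class**: the Aizenman–Burchard hypothesis `SAWTraversalBound` (verbatim the
route's support item stmt-1880: shell-dependent threshold `k`, `K ≥ 0`, `λ > 2`, `δ₀ > 0`) for the
endpoint approximations whose lattice endpoints eventually lie on `meshBoundary` — the class on which
Disproof F3 shows PA is instantiable and on which triage S1/X1 shows a G2 engine can work. -/
def SAWTraversalBoundBdry : Prop :=
  ∀ (D : DobrushinDomain) (a b : ℝ → Site 2), IsEndpointApprox D a b →
    (∀ᶠ δ in 𝓝[>] (0 : ℝ), a δ ∈ meshBoundary D.carrier δ ∧ b δ ∈ meshBoundary D.carrier δ) →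
    ∃ (k : ℂ → ℝ → ℝ → ℕ) (K lam δ₀ : ℝ), 0 ≤ K ∧ 2 < lam ∧ 0 < δ₀ ∧ ∀ δ ∈ Set.Ioc (0 : ℝ) δ₀,
      ∀ (x : ℂ) (ρ R : ℝ), δ ≤ ρ → ρ < R → R ≤ 1 →
        law D.carrier δ (a δ) (b δ)
            {γ | (⟨γ.walk.toCurve (meshPoint δ)⟩ : Curve ℂ).HasTraversals (k x ρ R) x ρ R} ≤
          ENNReal.ofReal (K * (ρ / R) ^ lam)

/-! ## Stubs (registered; `sorry` only here) -/

/-- STUB 1 (SEED; conjecture-grade; HARDEST) — boundary-attached Hölder-weak Brownian domination,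
the repaired crux C′ of route `SAWBrownianDomination` (stmt-11295 notes 2026-08-15T17:21–17:28Z;
W2.lean).  Continuum-exact with `C = θ = 1` for boundary hulls (LSW03 restriction:
`P_{5/8}[avoid A] = Φ_A'^{5/8} ≥ Φ_A'`); lattice data: one-way corridor log-rate ratios .740/.676/.643
(θ < 5/8 slack needed, rattack-11182), hairpin (dead-end) rates SAW .1437/.2207 < RW .1459/.2241
(widths 2/3) — the sign this line needs; the dust (stmt-4862) and ring (stmt-11295) killers are
outside the boundary-attached class. -/
theorem stub_domination : DominationBdry := by
  sorry

/-- STUB 2 (theorem-grade, M/L) — weak discrete Beurling estimate for simple random walk on `δℤ²`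
killed at a connected obstacle crossing the annulus (Kesten; Lawler 1991 Thm 2.5.2; Lawler–Limic
2010 Prop. 6.8.1 weak form; KS17 Lemma 4.9 is the annulus form used for HE/LERW).  Any `β > 0`. -/
theorem stub_rwWeakBeurling : RWWeakBeurling := by
  sorry

/-- STUB 3 (L; the transfer) — domination + weak Beurling ⇒ G2 for the SAW at lattice prefixes on
the R1 class.  Ingredients: (i) EXACT domain Markov property of `SAW.law` (weights
`x_c^{|π|+|ω|}` factorise: conditionally on `γ.walk = π.append ω` the continuation `ω` has the law
`law D.carrier δ t (b δ)` conditioned on avoiding `π.support ∖ {t}`; Werner arXiv:math/0307353 §3.1);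
(ii) STRUCTURE of a charged crossing (KS17 Def. 2.2, proof of Lemma 3.6 p. 15: a crossed unforced
component `V` of `A ∩ U_π`, `U_π` the ROOTED slit domain, has monochromatic walls and the region
behind it is a DEAD END; the wall set `K := (closure D)ᶜ ∪ roots(a_δ) ∪ polyline(π minus last step)`
is CONNECTED and unbounded, meets `B̄(z₀, 2r)` (from `∂B(z₀,r) ∩ ∂U_π ≠ ∅`), and is disjoint from
every allowed edge — lattice segments meet only at lattice points; by the free-loop consistency
(`ℂ ∖ U_π` connected: a continuum detour and a lattice-forced dive would enclose wall material) a
continuum-avoidable component is lattice-avoidable, so no charged crossing is lattice-forced;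
Disproof §6 `noFloatingHoles` is the PA-side shadow of the same anchoring); (iii) the crossing forces
the continuation to visit the trap `S_V` (sites of `V` within `2r` of `z₀`, resp. beyond `R/2` for an
outward dead end), so `stub_domination` with `F = π.support ∖ {t}`, `z = t`, `w = b δ` bounds the
conditional probability by `C · (P^{RW-bridge}_{Ω_δ∖F}(t → b_δ)[visit S_V])^θ`; (iv) dead-end
decomposition of the bridge (`h`-transform, `h = G(·, b_δ)`) at the mouth of `V`: `h ≤ sup_mouth h`
behind the mouth (maximum principle), entrances at low-`h` sites are suppressed by the `h`-weighting,
and the comparison of `P_m(reach S_V)` with `h(m)/sup h` near the walls is a discrete BOUNDARY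
HARNACK estimate in a rough lattice domain (Chelkak's toolbox arXiv:1212.6205 §3; KS17 §4.3 handle the
analogous entrance problem for the harmonic explorer) — the delicate point (triage r1-2: "mouth
Harnack needs care"); serious tries (returns from `∂B(R)` to `∂B(R/2)` inside `V`) are geometric in
number because each is absorbed by `K` with probability `≥ c` — then `stub_rwWeakBeurling` gives
`≤ c₂ (r/R)^β`; (v) `C₀ := max(8, (2 C c₂^θ)^{1/(βθ)})`; time zero is treated at time one (first
step), since `F = η.support` is never empty.  The lead may split (iv) off as an RW-only stub. -/
theorem stub_g2_of_domination : DominationBdry → RWWeakBeurling → G2SAW := by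
  sorry

/-- STUB 4 (L/XL; charted) — G2 at lattice prefixes ⇒ (H1) on the R1 class, per `(D, a, b)`:
KS17 §3.2, Prop. 3.5 with Lemma 3.6 (index of the annulus w.r.t. the slit domain changes by `±1` per
crossing of the middle sub-annulus; an index increase of `2n-1` during a minimal crossing forces
`2n-1` unforced crossings of the three sub-annuli `A_k = A(z₀, C₀^{k-1} r, C₀^k r)`), run in the
Jordan domain `D` itself (no conformal invariance is available for the SAW): the number `n₀` of
FORCED crossings of `D(x; ρ, R)` is bounded by the number of traversals of the shell by `∂D`
(finite for each shell, `Curve.exists_not_hasTraversals`) and goes into the shell-dependent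
threshold `k(x, ρ, R) := n₀(x, ρ, R) + 2m + 2` exactly as in the FK-Ising template
`fkInterface_traversalBound_of_annulusCrossing_le` (`k = 2(j + N(ρ))`); G2 is applied `m` times at
the lattice prefixes ending the crossings (rounding KS's hitting times up to the next lattice vertex
costs `≤ δ ≤ ρ`, absorbed by `C₀ ≥ 8`); chaining over `⌊log_{C₀³}(R/ρ)⌋` scales gives
`P ≤ (ρ/R)^{m Δ/6}`, `Δ = log 2 / log C₀`, so `λ > 2` for `m > 12/Δ`; the trivial regime
`R < C₀³ ρ` is paid by `K`.  Marked points: `R ≤ 1` does not keep `a_δ, b_δ` out of the shell — use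
KS's square-root re-centring (p. 15) or count the (at most 2) extra forced crossings in `n₀`. -/
theorem stub_h1_of_g2 : G2SAW → SAWTraversalBoundBdry := by
  sorry

/-- STUB 5 (OPEN; no mechanism in this line; the shared IOU of every line on this crux) —
the DEEP-ENDPOINT REDUCTION: (H1) for boundary-attached endpoint approximations implies (H1) for all
`IsEndpointApprox` (which admits starts at Euclidean depth `√δ`, lattice depth `→ ∞`:
`TPToTraversalBound.Negative.exists_isEndpointApprox_deepStart`).  Why it is separate: for a
floating past `Ω_δ ∖ past` is a lattice ring and G2 fails with conditional probability `→ 1`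
(triage S1: .905/.947/.971/.985/.992/.996 at L = 2…12; X1), so no engine uniform in the past —
neither PA (Disproof F3 `not_presentable_of_enclosed`) nor domination (ring witness of stmt-11295) —
reaches this fragment; it needs an estimate AVERAGED over pasts (interior/whole-plane multi-return
bound for the x_c-SAW near its deep starting point: 3 legs per return, Disproof F3 upshot), or the
statement-level repair R1 of `SAWTraversalBound` (Duminil-Copin–Smirnov take the CLOSEST vertices),
which would make this stub vacuous.  Believed true ((H1) is). -/
theorem stub_deepEndpointReduction : SAWTraversalBoundBdry → SAWTraversalBound := by
  sorry

/-! ## Sorry-free remarks -/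

/-- The seed is a WEAKENING of the sibling route's crux as typed: a proof of
`SAWBrownianDomination.UniformDomination` (stmt-11295, all walks `η`) closes `stub_domination`
(drop the boundary hypothesis).  (The converse fails: the as-typed item has a standing ring
witness.) -/
theorem dominationBdry_of_uniformDomination
    (h : Summit.CriticalPhenomena.SAWScalingLimit.Theses.SAWBrownianDomination.UniformDomination) :
    DominationBdry := by
  obtain ⟨C, θ, hθ, hUD⟩ := h
  exact ⟨C, θ, hθ, fun J δ u v η S z w hδ _ => hUD J δ u v η S z w hδ⟩

/-- The R1 restriction is a genuine restriction of (H1): the boundary-class statement follows from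
the full one by discarding the hypothesis (so `stub_deepEndpointReduction` is the exact gap). -/
theorem traversalBoundBdry_of_traversalBound (h : SAWTraversalBound) : SAWTraversalBoundBdry :=
  fun D a b hab _ => h D a b hab

/-- The rooted carrier is a sub-domain of the carrier (rooting only removes the root segments). -/
theorem rootedCarrier_subset (Ω : Set ℂ) (δ : ℝ) (v : Site 2) : rootedCarrier Ω δ v ⊆ Ω :=
  fun _ h => h.1

/-- Away from the lattice boundary nothing is rooted: if every `ℤ²`-neighbour of `v` is joined to
`v` in `Ω_δ` (in particular if `v ∉ meshBoundary Ω δ` and `v ∈ meshDomain Ω δ`), the rooted carrier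
is the carrier — so on a FLOATING start `G2SAW`'s event is KS's verbatim, and triage S1 applies. -/
theorem rootedCarrier_eq_of_forall_adj {Ω : Set ℂ} {δ : ℝ} {v : Site 2}
    (h : ∀ y, (zdGraph 2).Adj v y → (discreteDomainGraph Ω δ).Adj v y) :
    rootedCarrier Ω δ v = Ω := by
  have hU : (⋃ y ∈ {y : Site 2 | (zdGraph 2).Adj v y ∧ ¬ (discreteDomainGraph Ω δ).Adj v y},
      (segment ℝ (meshPoint δ v) (meshPoint δ y) \ {meshPoint δ y})) = ∅ := by
    refine Set.eq_empty_of_forall_notMem fun z hz => ?_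
    rw [Set.mem_iUnion₂] at hz
    obtain ⟨y, hy, -⟩ := hz
    exact hy.2 (h y hy.1)
  rw [rootedCarrier, hU]
  simp

/-- G2 is only ever consumed one annulus and one prefix at a time; in particular the empty-annulus
clause of KS Def. 2.2 is built into the event: if the inner circle misses `∂(U ∖ past)` (for the
rooted carrier `U`) the charged event is empty (tree lemma `unforcedPart_eq_empty`), whatever the
law. -/
theorem g2_event_empty_of_inner_circle_free {D : DobrushinDomain} {δ : ℝ} {a b t : Site 2}
    (π : (discreteDomainGraph D.carrier δ).Walk a t) {z₀ : ℂ} {r R : ℝ}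
    (h : Metric.sphere z₀ r ∩ frontier (rootedCarrier D.carrier δ a \ (CurveClass.mk
      (⟨π.toCurve (meshPoint δ)⟩ : Curve ℂ)).range) = ∅) :
    {γ : DomainSAW D.carrier δ a b | ∃ ω : (discreteDomainGraph D.carrier δ).Walk t b,
        γ.walk = π.append ω ∧
          (⟨ω.toCurve (meshPoint δ)⟩ : Curve ℂ).MakesCrossingIn z₀ r R
            (unforcedPart (rootedCarrier D.carrier δ a) (meshPoint δ b)
              (CurveClass.mk ⟨π.toCurve (meshPoint δ)⟩) z₀ r R)} = ∅ := by
  refine Set.eq_empty_of_forall_notMem fun γ hγ => ?_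
  obtain ⟨ω, -, s, u, hsu, -, hin⟩ := hγ
  rw [unforcedPart_eq_empty h] at hin
  -- a crossing has an interior parameter strictly between its ends
  obtain ⟨m, hsm, hmu⟩ := exists_between hsu
  exact (hin m hsm hmu).2

/-! ## Composition (sorry-free) -/

/-- **`FKGToTraversalBound` from the stubs.**  The crux is `LeftRightFKG → SAWTraversalBound`
(`Iff.rfl`); this line proves the consequent outright (Disproof F1 `of_traversalBound`: PA is
discarded): domination (stub 1) and weak Beurling (stub 2) give G2 at lattice prefixes on the R1
class (stub 3), KS §3.2 turns it into (H1) on the R1 class (stub 4), and the deep-endpoint reduction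
(stub 5) lifts it to every endpoint approximation. -/
theorem FKGToTraversalBound_of : FKGToTraversalBound := fun _ =>
  stub_deepEndpointReduction
    (stub_h1_of_g2 (stub_g2_of_domination stub_domination stub_rwWeakBeurling))

end Summit.CriticalPhenomena.SAWScalingLimit.Cruxes.FKGToTraversalBound.BrownianDominationClosesG2

end
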